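import Summits.Ventures.CertifiedQuantumChemistry.Rows.MaximalSpinProjectionRelaxationKernel
import Literature.MathematicalPhysics.QuantumChemistry.SingletRestrictedRelaxation
import HarnessLib

/-!
# Ventures/CertifiedQuantumChemistry — Rows/SingletRelaxationRowEquivalence.lean: at EVERY feasible
# point of the PRINTED singlet-restricted programme the cell's E3 / E4a / E4b rows hold and the
# one-matrix is spin-symmetric; the printed programme and the cell's `s2` / `s2v` rows cut out THE
# SAME set; the REDUNDANCY LEMMA in value form; the singlet lower bound over the cell's rows
# (rdm-A, addendum 18, theorem F3.3 — relaxation level; part 2 of 2: the singlet programme)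

HONEST FRAMING (verbatim): certified bounds for a stated model Hamiltonian in a stated basis; not a
claim about the real molecule beyond that model.

Seat rdm-A (gen 57), zero compute; ROWS courtesy file (no row, no claim node, no certificate sentence,
nothing asserted about any model; no instance, reader or FORMAT byte changes; generator-B independence
untouched). Part 1 (`Rows/MaximalSpinProjectionRelaxationKernel.lean`) showed, on every sector of the
printed `S_z`-sector DQG programme, that the value `X(Γ) = N_β` (resp. `= N_α`) of Mazziotti's row (98)
at `M = S` (resp. `M = −S`) makes the `Ŝ_+` (resp. `Ŝ_−`) coefficient vector a kernel vector of
`G(γ, Γ)`, i.e. the cell's E3 and E4a (resp. E4b-shaped) rows. The typer's PRINTED singlet-restricted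
programme `IsDQGFeasibleSinglet n γ Γ` (`Literature/…/SingletRestrictedRelaxation`: sector DQG at
`(n, n)` + row (98) at `S = M = 0`, `X(Γ) = n`) satisfies BOTH hypotheses at once. Here:

* §3 THE SINGLET PROGRAMME (`IsDQGFeasibleSinglet n`, `a = b = n = X`): both kernels at once, so at
  EVERY singlet-feasible pair E3, all `k²` E4a rows, all `k²` E4b rows hold
  (`sum_gMap_downUp_eq_zero_of_isDQGFeasibleSinglet`, `e4a_of_isDQGFeasibleSinglet`,
  `e4b_of_isDQGFeasibleSinglet`), and — the relaxation-level twin of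
  "a singlet has a spin-free one-matrix" — **`one_up_eq_one_down_of_isDQGFeasibleSinglet`:
  `γ_{pα,qα} = γ_{pβ,qβ}` for all `p, q`**, at every feasible point of the PRINTED singlet programme,
  `N`-representable or not (E4a and E4b have the same two-body side once `Γ` is re-sorted by
  antisymmetry).
* §4 THE ROW SETS COINCIDE (addendum 18 §18.4 (i), singlet class, DQG and DQGT1T2′ rungs):
  `isDQGFeasibleSinglet_iff_sum_gMap` (printed (98) ⟺ sector rows + the cell's E3 row, the
  `⟨Ŝ_−Ŝ_+⟩`-form of the `G`-map `= 0`), `isDQGFeasibleSinglet_iff_e4a`, `isDQGFeasibleSinglet_iff_e4b`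
  (⟺ sector rows + the E4a family alone, resp. the E4b family alone: E3 `= Σ_p` E4a`(p,p)`),
  `isDQGFeasibleSinglet_iff_spinContract` (`n ≠ 0`: ⟺ DQG at `N = 2n` + the `S_z` selection rule of
  `γ` + E1 + the four E2 families + E3 — with `Rows/GMatrixRelaxationKernel.lean`:
  𝔓_print(DQG; `N = 2n`, `S = 0`) = 𝔓_ours(`s2`) = 𝔓_ours(`s2v`) as subsets of the abstract pairs),
  `isDQGT1T2PrimeFeasibleSinglet_iff_sum_gMap` (the three-index rung).
* §5 VALUES AND THE BOUND IN CELL-ROW FORM: `pqgSingletEnergy_eq_sInf_rows` (FORMAT-qcl1 §5 REDUNDANCY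
  LEMMA in value form: adjoining the E4a, E4b and `γ_αα = γ_ββ` rows to the singlet programme changes
  neither the feasible set nor `E_PQG(2n, S = 0)`), `le_minEnergyOn_singlet_of_forall_rows` and
  `le_minEnergyOn_singlet_of_forall_spinContract_rows` (`n ≠ 0`): any real `c` below the energy
  functional on the pairs satisfying the cell's rows is `≤ E₀(Ĥ; N = 2n, S = 0)` — the typer's
  `le_minEnergyOn_singlet_of_forall_isDQGFeasibleSinglet` restated over the rows a qcl1 `s2` / `s2v`
  instance actually carries.

Everything is PROVED (0 sorry, 0 def); rdm-B's files are not imported (its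
`Rows/MaximalSpinProjectionRows.lean` §2 is the abstract E3 ⇒ E4a lemma; the link to the printed row,
the spin symmetry of `γ`, the set equalities and the value forms are what is added). NOT here:
anything about a pinned instance, a floating-point solve, or a certificate; `S > 0`; the spin-ADAPTED
blocks (Mazziotti (99)–(103)).

References: D. A. Mazziotti, Adv. Chem. Phys. 134 (Wiley, 2007) 21–59, §II.B eq. (15), §II.F.1
eqs. (96)–(98) (held volume `book:editornd-reduced-density-matrix-mechanics` pp. 50–51).
[cite: Mazziotti2007RDMChapter, §II.B eq. (15), §II.F.1 eqs. (96)-(98)]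
M. Nakata, B. J. Braams, K. Fujisawa, M. Fukuda, J. K. Percus, M. Yamashita, Z. Zhao, J. Chem. Phys.
128 (2008) 164113, §II.A–C (programme values as minima over the feasible sets; the spin row among the
linear conditions, "see Sec. II D of Ref. 25" = M. Fukuda et al., Math. Program. B 109 (2007) 553,
eq. (17), corpus `doi-10-1007-s10107-006-0027-y` p. 9). [cite: NakataEtAl2008, §II.A-C]
FORMAT-qcl1 v0.3.0 §5 E3/E4 + REDUNDANCY LEMMA (`HOME/pub-qchem-rdm/FORMAT-qcl1.md`).
-/

noncomputable section

namespace Summit.Ventures.CertifiedQuantumChemistry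

open Matrix Finset
open Literature.MathematicalPhysics.QuantumLattice Literature.MathematicalPhysics.QuantumChemistry
open scoped ComplexOrder

variable {Λ : Type*} [LinearOrder Λ] [Fintype Λ]

/-! ### §3 The singlet-restricted programme: both kernels, E3, E4a, E4b and `γ_αα = γ_ββ` -/

section Singlet

variable {n : ℕ} {γ : Matrix (Orb Λ) (Orb Λ) ℂ} {Γ : Matrix (Orb Λ × Orb Λ) (Orb Λ × Orb Λ) ℂ}

/-- **The cell's E3 row holds at every feasible point of the PRINTED singlet programme**
(`IsDQGFeasibleSinglet n`: sector rows at `(n, n)` + Mazziotti (98) at `S = M = 0`):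
`Σ_{pq} G_{(pβ,pα),(qβ,qα)} = 0` (FORMAT-qcl1 §5 E3 with right-hand side `S(S+1) − M(M+1) = 0`). -/
theorem sum_gMap_downUp_eq_zero_of_isDQGFeasibleSinglet (h : IsDQGFeasibleSinglet n γ Γ) :
    ∑ p : Λ, ∑ q : Λ, gMap γ Γ (orb p 1, orb p 0) (orb q 1, orb q 0) = 0 :=
  sum_gMap_downUp_eq_zero_of_exchange_eq_numDown h.toIsDQGFeasibleSector h.exchange_sum

/-- The flipped (`⟨Ŝ_+Ŝ_−⟩`) form also vanishes on the singlet programme (`N_α = N_β = n`). -/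
theorem sum_gMap_upDown_eq_zero_of_isDQGFeasibleSinglet (h : IsDQGFeasibleSinglet n γ Γ) :
    ∑ p : Λ, ∑ q : Λ, gMap γ Γ (orb p 0, orb p 1) (orb q 0, orb q 1) = 0 :=
  sum_gMap_upDown_eq_zero_of_exchange_eq_numUp h.toIsDQGFeasibleSector h.exchange_sum

/-- **Both `Ŝ_±` coefficient vectors are kernel vectors of `G(γ, Γ)`** at every singlet-feasible
pair: `Σ_r G_{m,(rβ,rα)} = 0` and `Σ_r G_{m,(rα,rβ)} = 0` for every `m` (column forms). -/
theorem sum_gMap_col_eq_zero_of_isDQGFeasibleSinglet (h : IsDQGFeasibleSinglet n γ Γ)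
    (m : Orb Λ × Orb Λ) :
    ∑ r : Λ, gMap γ Γ m (orb r 1, orb r 0) = 0 ∧ ∑ r : Λ, gMap γ Γ m (orb r 0, orb r 1) = 0 :=
  ⟨sum_gMap_col_downUp_eq_zero_of_exchange_eq_numDown h.toIsDQGFeasibleSector h.exchange_sum m,
    sum_gMap_col_upDown_eq_zero_of_exchange_eq_numUp h.toIsDQGFeasibleSector h.exchange_sum m⟩

/-- The row forms: `Σ_r G_{(rβ,rα),m} = 0` and `Σ_r G_{(rα,rβ),m} = 0` for every `m`. -/
theorem sum_gMap_row_eq_zero_of_isDQGFeasibleSinglet (h : IsDQGFeasibleSinglet n γ Γ)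
    (m : Orb Λ × Orb Λ) :
    ∑ r : Λ, gMap γ Γ (orb r 1, orb r 0) m = 0 ∧ ∑ r : Λ, gMap γ Γ (orb r 0, orb r 1) m = 0 :=
  ⟨sum_gMap_row_downUp_eq_zero_of_exchange_eq_numDown h.toIsDQGFeasibleSector h.exchange_sum m,
    sum_gMap_row_upDown_eq_zero_of_exchange_eq_numUp h.toIsDQGFeasibleSector h.exchange_sum m⟩

/-- **E4a at every singlet-feasible pair**: `γ_{pβ,qβ} = Σ_r Γ_{(pβ,rα),(rβ,qα)}` for all `p, q`
(FORMAT-qcl1 §5 E4a; rdm-B's state-level `oneRDM_down_eq_sum_twoRDM`, now for every feasible point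
of the printed relaxation). -/
theorem e4a_of_isDQGFeasibleSinglet (h : IsDQGFeasibleSinglet n γ Γ) (p q : Λ) :
    γ (orb p 1) (orb q 1) = ∑ r : Λ, Γ (orb p 1, orb r 0) (orb r 1, orb q 0) :=
  e4a_of_exchange_eq_numDown h.toIsDQGFeasibleSector h.exchange_sum p q

/-- **E4b at every singlet-feasible pair**: `γ_{pα,qα} = Σ_r Γ_{(rα,pβ),(qα,rβ)}` for all `p, q`
(FORMAT-qcl1 §5 E4b, the `2S = 0` rows; rdm-B's state-level `oneRDM_up_eq_sum_twoRDM`). -/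
theorem e4b_of_isDQGFeasibleSinglet (h : IsDQGFeasibleSinglet n γ Γ) (p q : Λ) :
    γ (orb p 0) (orb q 0) = ∑ r : Λ, Γ (orb r 0, orb p 1) (orb q 0, orb r 1) :=
  e4b_of_exchange_eq_numUp h.toIsDQGFeasibleSector h.exchange_sum p q

/-- **A SPIN-SYMMETRIC ONE-MATRIX AT EVERY FEASIBLE POINT OF THE PRINTED SINGLET PROGRAMME.**
For every pair feasible for the `S_z`-sector DQG programme at `(n, n)` with Mazziotti's row (98) at
`S = 0` — `N`-representable or not — `γ_{pα,qα} = γ_{pβ,qβ}` for all `p, q`: E4b and E4a have the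
same two-body side `Σ_r Γ_{(pβ,rα),(rβ,qα)}` once `Γ` is re-sorted by fermionic antisymmetry
(FORMAT-qcl1 §5 "Relations: E4a(p,q) − E4b(p,q) = γ^β_{pq} − γ^α_{pq}"; rdm-B's state-level
`oneRDM_up_eq_oneRDM_down_of_singlet`). The relaxation never needs a `γ_αα = γ_ββ` row: (98) and
`G ⪰ 0` already enforce it. -/
theorem one_up_eq_one_down_of_isDQGFeasibleSinglet (h : IsDQGFeasibleSinglet n γ Γ) (p q : Λ) :
    γ (orb p 0) (orb q 0) = γ (orb p 1) (orb q 1) := by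
  rw [e4b_of_isDQGFeasibleSinglet h p q, e4a_of_isDQGFeasibleSinglet h p q]
  refine Finset.sum_congr rfl fun r _ => ?_
  rw [h.dqg.swap_fst (orb p 1) (orb r 0) (orb q 0, orb r 1),
    h.dqg.swap_snd (orb p 1, orb r 0) (orb r 1) (orb q 0), neg_neg]

/-- The spin-flip kernel sums on the singlet programme (both families of part 1, §2): for every `P`
and every `q`, `Σ_r Γ_{(P,rα),(rβ,qβ)} = 0` and `Σ_r Γ_{(P,rβ),(rα,qα)} = 0`. -/
theorem sum_two_flip_eq_zero_of_isDQGFeasibleSinglet (h : IsDQGFeasibleSinglet n γ Γ) (P : Orb Λ)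
    (q : Λ) :
    ∑ r : Λ, Γ (P, orb r 0) (orb r 1, orb q 1) = 0 ∧
      ∑ r : Λ, Γ (P, orb r 1) (orb r 0, orb q 0) = 0 :=
  ⟨sum_two_flip_eq_zero_of_exchange_eq_numDown h.toIsDQGFeasibleSector h.exchange_sum P q,
    sum_two_flip_eq_zero_of_exchange_eq_numUp h.toIsDQGFeasibleSector h.exchange_sum P q⟩

end Singlet

/-! ### §4 The printed singlet programme and the cell's `s2` / `s2v` rows cut out the same set -/

section RowSets

variable (n : ℕ) (γ : Matrix (Orb Λ) (Orb Λ) ℂ) (Γ : Matrix (Orb Λ × Orb Λ) (Orb Λ × Orb Λ) ℂ)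

/-- **Printed row (98) ⟺ the cell's E3 row** (on top of the printed sector rows at `(n, n)`): a pair
is feasible for the singlet-restricted DQG programme iff it is sector-feasible and the
`⟨Ŝ_−Ŝ_+⟩`-form of its `G`-map vanishes — addendum 18 §18.4 (i), singlet class, DQG rung:
𝔓_print(DQG; `N = 2n`, `S = 0`) = 𝔓_ours(`s2`) at the level of these predicates. -/
theorem isDQGFeasibleSinglet_iff_sum_gMap :
    IsDQGFeasibleSinglet n γ Γ ↔
      IsDQGFeasibleSector n n γ Γ ∧
        ∑ p : Λ, ∑ q : Λ, gMap γ Γ (orb p 1, orb p 0) (orb q 1, orb q 0) = 0 := by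
  constructor
  · exact fun h => ⟨h.toIsDQGFeasibleSector, sum_gMap_downUp_eq_zero_of_isDQGFeasibleSinglet h⟩
  · rintro ⟨h, h0⟩
    refine ⟨h, ?_⟩
    have h1 := sum_gMap_downUp_of_isDQGFeasibleSector h
    rw [h0] at h1
    exact (sub_eq_zero.mp h1.symm).symm

/-- **… ⟺ the E4a family alone** (E3 `= Σ_p` E4a`(p, p)`; conversely §3): feasible(`s2v`) =
feasible(`s2`) = the printed singlet-feasible set. -/
theorem isDQGFeasibleSinglet_iff_e4a :
    IsDQGFeasibleSinglet n γ Γ ↔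
      IsDQGFeasibleSector n n γ Γ ∧
        ∀ p q : Λ, γ (orb p 1) (orb q 1) = ∑ r : Λ, Γ (orb p 1, orb r 0) (orb r 1, orb q 0) := by
  constructor
  · exact fun h => ⟨h.toIsDQGFeasibleSector, e4a_of_isDQGFeasibleSinglet h⟩
  · rintro ⟨h, hE⟩
    refine (isDQGFeasibleSinglet_iff_sum_gMap n γ Γ).2 ⟨h, ?_⟩
    rw [sum_gMap_downUp_eq, sub_eq_zero]
    exact Finset.sum_congr rfl fun p _ => hE p p

/-- **… ⟺ the E4b family alone** (the flipped form `= Σ_p` E4b`(p, p)` and `N_α = N_β`). -/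
theorem isDQGFeasibleSinglet_iff_e4b :
    IsDQGFeasibleSinglet n γ Γ ↔
      IsDQGFeasibleSector n n γ Γ ∧
        ∀ p q : Λ, γ (orb p 0) (orb q 0) = ∑ r : Λ, Γ (orb r 0, orb p 1) (orb q 0, orb r 1) := by
  constructor
  · exact fun h => ⟨h.toIsDQGFeasibleSector, e4b_of_isDQGFeasibleSinglet h⟩
  · rintro ⟨h, hE⟩
    refine ⟨h, ?_⟩
    have h1 := sum_gMap_upDown_of_isDQGFeasibleSector h
    have h0 : ∑ p : Λ, ∑ q : Λ, gMap γ Γ (orb p 0, orb p 1) (orb q 0, orb q 1) = 0 := by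
      rw [sum_gMap_upDown_eq, sub_eq_zero, Finset.sum_comm]
      exact Finset.sum_congr rfl fun p _ => hE p p
    rw [h0] at h1
    exact (sub_eq_zero.mp h1.symm).symm

variable {n} in
/-- **The printed singlet programme in the cell's row vocabulary** (`n ≠ 0`; with
`Rows/GMatrixRelaxationKernel.lean`): a pair is singlet-feasible iff it is DQG feasible at `N = 2n`
and satisfies the `S_z` selection rule of `γ`, the two spin traces E1, the four families of
spin-resolved contraction rows E2 and the E3 row — exactly the rows of a qcl1 `s2=0` instance
(FORMAT-qcl1 §5; FORMAT emits the `p ≤ q` half of E2, the `(q, p)` row being the conjugate row). Hence,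
in exact arithmetic and at the level of these predicates, the printed `DQG + (98)` programme and the
cell's `s2` (and, by `isDQGFeasibleSinglet_iff_e4a`, `s2v`) programme have one and the same feasible
set and the same optimum for every objective. -/
theorem isDQGFeasibleSinglet_iff_spinContract (hn : n ≠ 0) :
    IsDQGFeasibleSinglet n γ Γ ↔
      IsDQGFeasible (n + n) γ Γ ∧
        (∀ p q : Λ, ∀ σ τ : Fin 2, σ ≠ τ → γ (orb p σ) (orb q τ) = 0) ∧
        ∑ x : Λ, γ (orb x 0) (orb x 0) = n ∧ ∑ x : Λ, γ (orb x 1) (orb x 1) = n ∧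
        (∀ p q : Λ,
          ∑ y : Λ, Γ (orb p 0, orb y 0) (orb q 0, orb y 0) = ((n : ℂ) - 1) * γ (orb p 0) (orb q 0)) ∧
        (∀ p q : Λ,
          ∑ y : Λ, Γ (orb p 0, orb y 1) (orb q 0, orb y 1) = (n : ℂ) * γ (orb p 0) (orb q 0)) ∧
        (∀ p q : Λ,
          ∑ y : Λ, Γ (orb p 1, orb y 1) (orb q 1, orb y 1) = ((n : ℂ) - 1) * γ (orb p 1) (orb q 1)) ∧
        (∀ p q : Λ,
          ∑ y : Λ, Γ (orb p 1, orb y 0) (orb q 1, orb y 0) = (n : ℂ) * γ (orb p 1) (orb q 1)) ∧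
        ∑ p : Λ, ∑ q : Λ, gMap γ Γ (orb p 1, orb p 0) (orb q 1, orb q 0) = 0 := by
  have hnn : n + n ≠ 0 := by omega
  rw [isDQGFeasibleSinglet_iff_sum_gMap, isDQGFeasibleSector_iff_spinContract hnn]
  simp only [and_assoc]

/-- **The three-index rung**: a pair is feasible for the singlet-restricted `PQGT1T2′` programme iff
it is feasible for the sector `PQGT1T2′` programme at `(n, n)` and the cell's E3 row holds. -/
theorem isDQGT1T2PrimeFeasibleSinglet_iff_sum_gMap :
    IsDQGT1T2PrimeFeasibleSinglet n γ Γ ↔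
      IsDQGT1T2PrimeFeasibleSector n n γ Γ ∧
        ∑ p : Λ, ∑ q : Λ, gMap γ Γ (orb p 1, orb p 0) (orb q 1, orb q 0) = 0 := by
  constructor
  · exact fun h =>
      ⟨h.toIsDQGT1T2PrimeFeasibleSector, sum_gMap_downUp_eq_zero_of_isDQGFeasibleSinglet h.toIsDQGFeasibleSinglet⟩
  · rintro ⟨h, h0⟩
    exact ⟨h,
      ((isDQGFeasibleSinglet_iff_sum_gMap n γ Γ).2 ⟨h.toIsDQGFeasibleSector, h0⟩).exchange_sum⟩

end RowSets

/-! ### §5 Values and the singlet lower bound in the cell's row form -/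

section Values

variable (h : Λ → Λ → ℂ) (g : Λ → Λ → Λ → Λ → ℂ) (hnuc : ℂ)

/-- **FORMAT-qcl1 §5 REDUNDANCY LEMMA, value form.** `E_PQG(N = 2n, S = 0)` — the infimum of
`Re E(γ, Γ)` over the printed singlet-feasible set — is also the infimum over the sector-feasible pairs
at `(n, n)` satisfying the cell's E3 row, ALL E4a rows, ALL E4b rows and the spin symmetry
`γ_αα = γ_ββ`: adjoining the redundant rows changes neither the feasible set nor the optimum (they
are the explicit facial-reduction equalities of the face of the `G` cone that E3 exposes). -/
theorem pqgSingletEnergy_eq_sInf_rows (n : ℕ) :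
    pqgSingletEnergy h g hnuc n =
      sInf {E : ℝ | ∃ γ Γ, IsDQGFeasibleSector n n γ Γ ∧
        ∑ p : Λ, ∑ q : Λ, gMap γ Γ (orb p 1, orb p 0) (orb q 1, orb q 0) = 0 ∧
        (∀ p q : Λ, γ (orb p 1) (orb q 1) = ∑ r : Λ, Γ (orb p 1, orb r 0) (orb r 1, orb q 0)) ∧
        (∀ p q : Λ, γ (orb p 0) (orb q 0) = ∑ r : Λ, Γ (orb r 0, orb p 1) (orb q 0, orb r 1)) ∧
        (∀ p q : Λ, γ (orb p 0) (orb q 0) = γ (orb p 1) (orb q 1)) ∧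
        E = (rdmEnergy h g hnuc γ Γ).re} := by
  unfold pqgSingletEnergy
  congr 1
  ext E
  constructor
  · rintro ⟨γ, Γ, hf, rfl⟩
    exact ⟨γ, Γ, hf.toIsDQGFeasibleSector, sum_gMap_downUp_eq_zero_of_isDQGFeasibleSinglet hf,
      e4a_of_isDQGFeasibleSinglet hf, e4b_of_isDQGFeasibleSinglet hf,
      one_up_eq_one_down_of_isDQGFeasibleSinglet hf, rfl⟩
  · rintro ⟨γ, Γ, hf, h3, -, -, -, rfl⟩
    exact ⟨γ, Γ, (isDQGFeasibleSinglet_iff_sum_gMap n γ Γ).2 ⟨hf, h3⟩, rfl⟩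

/-- **THE SINGLET-RESTRICTED LOWER BOUND over the cell's rows.** For `n ≤ |Λ|`: if a real `c` lies
below the energy functional on every pair that is sector-feasible at `(n, n)` and satisfies the E3 row,
all E4a rows, all E4b rows and `γ_αα = γ_ββ` (the rows a qcl1 `s2v` instance carries, and one it
could), then `c ≤ E₀(Ĥ; N = 2n, S = 0)`, the lowest energy of `Ĥ` on `(n,n)-sector ⊓ ker Ŝ_+` — the
typer's `le_minEnergyOn_singlet_of_forall_isDQGFeasibleSinglet` with the hypothesis weakened to the
cell's row set (§3 supplies the rows at every singlet-feasible pair). -/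
theorem le_minEnergyOn_singlet_of_forall_rows {n : ℕ} (hn : n ≤ Fintype.card Λ) {c : ℝ}
    (hc : ∀ γ Γ, IsDQGFeasibleSector n n γ Γ →
      ∑ p : Λ, ∑ q : Λ, gMap γ Γ (orb p 1, orb p 0) (orb q 1, orb q 0) = 0 →
      (∀ p q : Λ, γ (orb p 1) (orb q 1) = ∑ r : Λ, Γ (orb p 1, orb r 0) (orb r 1, orb q 0)) →
      (∀ p q : Λ, γ (orb p 0) (orb q 0) = ∑ r : Λ, Γ (orb r 0, orb p 1) (orb q 0, orb r 1)) →
      (∀ p q : Λ, γ (orb p 0) (orb q 0) = γ (orb p 1) (orb q 1)) →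
      c ≤ (rdmEnergy h g hnuc γ Γ).re) :
    c ≤ (molecularHamiltonian h g hnuc).minEnergyOn
      (szSector (n + n) (((n : ℝ) - n) / 2) ⊓ LinearMap.ker (Matrix.toLin'
        (spinPlus : Matrix (Finset (Orb Λ)) (Finset (Orb Λ)) ℂ))) :=
  le_minEnergyOn_singlet_of_forall_isDQGFeasibleSinglet h g hnuc hn fun γ Γ hf =>
    hc γ Γ hf.toIsDQGFeasibleSector (sum_gMap_downUp_eq_zero_of_isDQGFeasibleSinglet hf)
      (e4a_of_isDQGFeasibleSinglet hf) (e4b_of_isDQGFeasibleSinglet hf)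
      (one_up_eq_one_down_of_isDQGFeasibleSinglet hf)

/-- **The same bound over the FULL qcl1 row list** (`0 < n ≤ |Λ|`): DQG at `N = 2n`, the `S_z`
selection rule, E1, the four E2 families (`Rows/GMatrixRelaxationKernel.lean`), E3, E4a, E4b. Any `c`
below the functional on the pairs satisfying these rows — e.g. a certified dual bound of a qcl1
`s2=0` / `s2v` instance read at the level of these predicates — is `≤ E₀(Ĥ; N = 2n, S = 0)`. -/
theorem le_minEnergyOn_singlet_of_forall_spinContract_rows {n : ℕ} (hn0 : n ≠ 0)
    (hn : n ≤ Fintype.card Λ) {c : ℝ}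
    (hc : ∀ γ Γ, IsDQGFeasible (n + n) γ Γ →
      (∀ p q : Λ, ∀ σ τ : Fin 2, σ ≠ τ → γ (orb p σ) (orb q τ) = 0) →
      ∑ x : Λ, γ (orb x 0) (orb x 0) = n → ∑ x : Λ, γ (orb x 1) (orb x 1) = n →
      (∀ p q : Λ,
        ∑ y : Λ, Γ (orb p 0, orb y 0) (orb q 0, orb y 0) = ((n : ℂ) - 1) * γ (orb p 0) (orb q 0)) →
      (∀ p q : Λ,
        ∑ y : Λ, Γ (orb p 0, orb y 1) (orb q 0, orb y 1) = (n : ℂ) * γ (orb p 0) (orb q 0)) →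
      (∀ p q : Λ,
        ∑ y : Λ, Γ (orb p 1, orb y 1) (orb q 1, orb y 1) = ((n : ℂ) - 1) * γ (orb p 1) (orb q 1)) →
      (∀ p q : Λ,
        ∑ y : Λ, Γ (orb p 1, orb y 0) (orb q 1, orb y 0) = (n : ℂ) * γ (orb p 1) (orb q 1)) →
      ∑ p : Λ, ∑ q : Λ, gMap γ Γ (orb p 1, orb p 0) (orb q 1, orb q 0) = 0 →
      (∀ p q : Λ, γ (orb p 1) (orb q 1) = ∑ r : Λ, Γ (orb p 1, orb r 0) (orb r 1, orb q 0)) →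
      (∀ p q : Λ, γ (orb p 0) (orb q 0) = ∑ r : Λ, Γ (orb r 0, orb p 1) (orb q 0, orb r 1)) →
      c ≤ (rdmEnergy h g hnuc γ Γ).re) :
    c ≤ (molecularHamiltonian h g hnuc).minEnergyOn
      (szSector (n + n) (((n : ℝ) - n) / 2) ⊓ LinearMap.ker (Matrix.toLin'
        (spinPlus : Matrix (Finset (Orb Λ)) (Finset (Orb Λ)) ℂ))) := by
  have hnn : n + n ≠ 0 := by omega
  refine le_minEnergyOn_singlet_of_forall_isDQGFeasibleSinglet h g hnuc hn fun γ Γ hf => ?_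
  obtain ⟨hdqg, hsel, hup, hdown, haa, hab, hbb, hba⟩ :=
    (isDQGFeasibleSector_iff_spinContract hnn γ Γ).1 hf.toIsDQGFeasibleSector
  exact hc γ Γ hdqg hsel hup hdown haa hab hbb hba
    (sum_gMap_downUp_eq_zero_of_isDQGFeasibleSinglet hf) (e4a_of_isDQGFeasibleSinglet hf)
    (e4b_of_isDQGFeasibleSinglet hf)

end Values

end Summit.Ventures.CertifiedQuantumChemistry

end
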